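import Summits.QuantumFields.YangMills.Theorems.VirialFluxGapDecomposedCoercivity
import Literature.MathematicalPhysics.QuantumFieldTheory.LatticeGaugeDobrushinPoincare
import HarnessLib

/-!
# The symmetric operator of a bilinear form, and the Frobenius sum-of-squares form of linear matrix letters
# (generic front-end lemmas for the `hf`/`hcoer` inputs of the DIRECT Laplace road to ⟨stmt-QuantumFields-24204⟩ `VirialFluxGap.SharpTwistedLaplace`)

Helper module (free-hands work of width seat ym-line-sfw-p2-w2 g50, cell ym-idea-1; `--supports 24204`).  The orbit Laplace theorem takes its
quadratic phase as `½⟪Ay,y⟫` for a SYMMETRIC OPERATOR `A : V →ₗ V`; the phase model along the slice (✓`AnchorSlice.abs_ringDeficit_fixSlice_sub_chartModel_le`)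
delivers instead `½Σ_t ‖S_t(y)‖_F²` for finitely many `2×2`-matrix valued maps `S_t`, LINEAR in `y` (✓`sliceLetterA_add/smul`).  Here, generically:
* `exists_operator_of_bilin` — on a finite-dimensional real inner product space every bilinear form `B` is `⟪A·,·⟫` for a linear `A`
  (`A = Σ_j B(·, b_j) b_j` in an orthonormal basis); `isSymmetric_of_bilin` — `A` is symmetric when `B` is;
* `frobPair_self` — `Σ_{ij} Re(conj X_{ij}·X_{ij}) = ‖X‖_F²`;
* ★ `exists_symm_operator_sumSq_frob` — for finitely many LINEAR matrix letters `S_t : V →ₗ M_n(ℂ)`, `∃ A` symmetric with `⟪A y, y⟫ = Σ_t ‖S_t y‖_F²`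
  (the operator of the Frobenius bilinear form `(u,v) ↦ Σ_t Σ_{ij} Re(conj(S_t(u)_{ij})·S_t(v)_{ij})`; take `2A` for the `½⟪·,·⟫` normalisation).
Everything here is PROVED; no definitions, no named facts (namespace `Summit.QuantumFields.YangMills.Theorems.QuantitativeLaplace`).

HONEST FRAMING: linear algebra; ⟨24204⟩, ⟨24319⟩, ⟨22884⟩ and every rung stay OPEN; the Yang–Mills mass gap (Clay) is NOT touched; no summit is proved by a line.

## References
* K. W. Breitung, *Asymptotic Approximations for Probability Integrals*, LNM 1592 (1994), Lemma 7 p. 12. [Breitung1994]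
-/

set_option autoImplicit false

noncomputable section

open scoped RealInnerProductSpace BigOperators Matrix Matrix.Norms.Frobenius
open Finset Module
open Literature.MathematicalPhysics.QuantumFieldTheory (frobNorm frobNorm_eq_norm)

namespace Summit.QuantumFields.YangMills.Theorems.QuantitativeLaplace

variable {V : Type*} [NormedAddCommGroup V] [InnerProductSpace ℝ V] [FiniteDimensional ℝ V]

/-! ## §1 The operator of a bilinear form -/

/-- Every bilinear form on a finite-dimensional real inner product space is `⟪A·, ·⟫` for a linear operator `A`. [folklore] -/
theorem exists_operator_of_bilin (B : V →ₗ[ℝ] V →ₗ[ℝ] ℝ) : ∃ A : V →ₗ[ℝ] V, ∀ u v : V, ⟪A u, v⟫ = B u v := by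
  let b := stdOrthonormalBasis ℝ V
  refine ⟨∑ j, (B.flip (b j)).smulRight (b j), fun u v => ?_⟩
  rw [LinearMap.coe_sum, Finset.sum_apply, sum_inner]
  simp only [LinearMap.smulRight_apply, LinearMap.flip_apply, real_inner_smul_left]
  calc ∑ j, B u (b j) * ⟪b j, v⟫ = B u (∑ j, ⟪b j, v⟫ • b j) := by
        rw [map_sum]; exact Finset.sum_congr rfl fun j _ => by rw [map_smul, smul_eq_mul, mul_comm]
    _ = B u v := by rw [b.sum_repr' v]

omit [FiniteDimensional ℝ V] in
/-- The operator of a symmetric bilinear form is symmetric. [folklore] -/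
theorem isSymmetric_of_bilin {B : V →ₗ[ℝ] V →ₗ[ℝ] ℝ} (hB : ∀ u v, B u v = B v u) {A : V →ₗ[ℝ] V} (hA : ∀ u v : V, ⟪A u, v⟫ = B u v) :
    A.IsSymmetric := fun u v => by
  show ⟪A u, v⟫ = ⟪u, A v⟫
  rw [hA, hB, ← hA, real_inner_comm]

/-! ## §2 The Frobenius sum-of-squares form of linear matrix letters -/

section Frob

variable {ι : Type*} [Fintype ι] {n : Type*} [Fintype n]

/-- The real Frobenius pairing of two complex matrices, `Σ_{ij} Re(conj X_{ij} · Y_{ij})`, as a function. [folklore] -/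
theorem frobPair_self (X : Matrix n n ℂ) : (∑ i, ∑ j, (star (X i j) * X i j).re) = ‖X‖ ^ 2 := by
  rw [← frobNorm_eq_norm, frobNorm, Real.sq_sqrt (by positivity)]
  refine Finset.sum_congr rfl fun i _ => Finset.sum_congr rfl fun j _ => ?_
  rw [Complex.star_def, ← Complex.normSq_eq_conj_mul_self, Complex.normSq_eq_norm_sq]; norm_cast

/-- ★ **The symmetric operator of a Frobenius sum of squares**: for finitely many LINEAR matrix letters `S_t : V →ₗ M_n(ℂ)` there is a symmetric
`A : V →ₗ V` with `⟪A y, y⟫ = Σ_t ‖S_t y‖_F²` for every `y` (the operator of the bilinear form `(u,v) ↦ Σ_t Σ_{ij} Re(conj(S_t(u)_{ij})·S_t(v)_{ij})`).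
[cite: Breitung1994, Lemma 7 p. 12] -/
theorem exists_symm_operator_sumSq_frob (S : ι → (V →ₗ[ℝ] Matrix n n ℂ)) :
    ∃ A : V →ₗ[ℝ] V, A.IsSymmetric ∧ ∀ y : V, ⟪A y, y⟫ = ∑ t, ‖S t y‖ ^ 2 := by
  -- the Frobenius bilinear form of the letters
  let B : V →ₗ[ℝ] V →ₗ[ℝ] ℝ :=
    LinearMap.mk₂ ℝ (fun u v => ∑ t, ∑ i, ∑ j, (star (S t u i j) * S t v i j).re)
      (fun u u' v => by
        simp only [map_add, Matrix.add_apply, star_add, add_mul, Complex.add_re, Finset.sum_add_distrib])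
      (fun c u v => by
        simp only [map_smul, Matrix.smul_apply, Complex.real_smul, star_mul', Complex.star_def, Complex.conj_ofReal, mul_assoc,
          Complex.re_ofReal_mul, Finset.mul_sum, smul_eq_mul])
      (fun u v v' => by
        simp only [map_add, Matrix.add_apply, mul_add, Complex.add_re, Finset.sum_add_distrib])
      (fun c u v => by
        simp only [map_smul, Matrix.smul_apply, Complex.real_smul, Finset.mul_sum, smul_eq_mul]
        refine Finset.sum_congr rfl fun t _ => Finset.sum_congr rfl fun i _ => Finset.sum_congr rfl fun j _ => ?_
        rw [mul_left_comm, Complex.re_ofReal_mul])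
  have hBapply : ∀ u v, B u v = ∑ t, ∑ i, ∑ j, (star (S t u i j) * S t v i j).re := fun u v => rfl
  have hBsymm : ∀ u v, B u v = B v u := fun u v => by
    rw [hBapply, hBapply]
    refine Finset.sum_congr rfl fun t _ => Finset.sum_congr rfl fun i _ => Finset.sum_congr rfl fun j _ => ?_
    rw [← Complex.conj_re (star (S t u i j) * S t v i j)]
    simp only [map_mul, Complex.star_def, Complex.conj_conj, mul_comm]
  have hBself : ∀ y, B y y = ∑ t, ‖S t y‖ ^ 2 := fun y => by
    rw [hBapply]; exact Finset.sum_congr rfl fun t _ => frobPair_self (S t y)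
  obtain ⟨A, hA⟩ := exists_operator_of_bilin B
  exact ⟨A, isSymmetric_of_bilin hBsymm hA, fun y => by rw [hA, hBself]⟩

end Frob

end Summit.QuantumFields.YangMills.Theorems.QuantitativeLaplace
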